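import Summits.QuantumFields.YangMills.Theorems.BalabanUVNodesN15NeumannCubeDefect
import Summits.QuantumFields.YangMills.Theorems.BalabanUVNodesN15TwoGridEntry2
import Summits.QuantumFields.YangMills.Theorems.BalabanUVNodesN15TwoGridHolderStepsDiv
import HarnessLib

/-!
# Route «BalabanUVNodes» (K3⁷), node N15 = NE2, -a lane, PROGRAMME N file N-IIg: THE η-DEFECT OF A GENERAL IMAGES-DRESSED SANDWICH `χ_□∘Sym∘X∘M_{χ_□}` (exact identity + letter)
# and THE η-DEFECT LETTER OF ENTRY 2 `X = G∘∇*_ν` OF THE NEUMANN CUBES, HYPOTHESIS-FREE, rate `(L^k)^{−1∕(8(d+1))}`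

Cell `pub-ymgap`, seat `pub-ymgap-dag-n15-a` (KNIT-BY-NAME, g19; D-0062; chair R424 venue; `bears_on: R4∕N15`); `--kind proof --supports stmt-QuantumFields-20544 --as helper`.
Sequel of N-IIc `…N15NeumannCubeDefect` (the case `X = G`).  Inputs BY NAME: `hasMaj_twoGridDefect_div` (`…TwoGridEntry2`: the torus pair's entry 2 `𝔇(G′∇′*_ν, G∇*_ν)`, rate
`(L^k)^{−1∕(8(d+1))}`), part 44∕56 `hasMaj_divSteps_of_ineq` (`…TwoGridHolderStepsDiv`: Hölder one-step letter `ρ(s_κ − 1)∘G∘∇*_ν ≤ C(1∕n)^αe^{−δd}`), `ineq110_114_pair`; N-IIa∕b∕c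
(`idef_symOp_kingPrV`, `idef_mulOp_chiCube`, `faceTerm_eq`, `hasMaj_faceTerm`, `hasMaj_comp_mulOp_chiCube`), N-IIIb `hasMaj_chiCube_symOp_comp`.  CONSUMER: dag-n15-c's `hDK` rows
(FILE 45) through their Leibniz files — the defects of the cubes' `G_□∘E` pieces; entry 2's rows are N-IId `hasMaj_chiCube_symOp_gDivAdj_pair`.

WHAT.  §22 ★★★ `idef_chiCube_symOp_sandwich` (EXACT, any `X′, X`: `𝔇(χ′Sym′X′χ′, χSymXχ) = χ′∘Sym′∘𝔇(X′,X)∘M_χ + Σ_T M_{mask_T}∘P∘(χ∘R_T∘(D∘X∘M_χ))`), `sD_one`,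
★ `hasMaj_ownDiff_comp_of_steps` (`ρ(s_μ − 1)∘X ≤ Ce^{−δd}` ∀μ ⟹ `D∘X ≤ (d+1)Ce^{−δd}`), ★★★ `hasMaj_idef_chiCube_symOp_sandwich_of` (any torus `M_ν = 2S`: torus defect `C₀` + one-step
letters `C₁` ⟹ `≤ 1_□1_□·2^{d+1}e^{δ}(C₀ + (d+1)C₁)·e^{−δd}`), ★★★ `hasMaj_idef_chiCube_gDivAdj`: for odd `L ≥ 3`, `a > 0`: `∃ δ m > 0, ∀ m_T k r (k ≥ 1, L^k ≥ 4) (hL) c ν`,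
`𝔇(F′_□, F_□) ≤ 1_□(y)1_□(y′)·m·(L^k)^{−1∕(8(d+1))}·e^{−δ|y−y′|_T}` with `F_□ = χ_□∘Sym∘(G∘∇*_ν)∘M_{χ_□}` (faces: `(1∕L^k)^{½} ≤ (L^k)^{−1∕(8(d+1))}`).
HONEST FRAMING.  Lattice algebra + block-majorant bookkeeping over LANDED torus letters; no new analytic estimate; `U ≡ 1` torus MODEL on the doubled-cube family (one-cube model — ref-B
OBSERVATION-2∕CAUTION-P (4)); nothing of [B6]∕[B9] asserted; N15 NOT discharged (object-bound; NE2⁺ NOT PRINTED); counts UNMOVED (typed 28∕28 · discharged 5∕27); one finite torus pair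
per index — NOT continuum ∕ ℝ⁴ ∕ OS ∕ mass gap ∕ Clay.  Theorems only (0 `def`).
-/

noncomputable section

open scoped BigOperators Matrix
open Finset

namespace Summit.QuantumFields.YangMills.BalabanUVNodes.N15.TwoGrid

open Literature.MathematicalPhysics.QuantumFieldTheory.Balaban1983to89
open Literature.MathematicalPhysics.QuantumFieldTheory.Balaban1983to89.B5Prop11Plancherel (Tor fine unitVec)
open Literature.MathematicalPhysics.QuantumFieldTheory.Balaban1983to89.B5Block118 (up bpt)
open Literature.MathematicalPhysics.QuantumFieldTheory.Balaban1983to89.B6Prop26Gluing (mulOp mulOp_apply ind ind_nonneg ind_le_one)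
open Literature.MathematicalPhysics.QuantumFieldTheory.King1986.Torus (blockOf tdistT)
open Literature.MathematicalPhysics.QuantumFieldTheory.Balaban1983to89.B11SectG (BlockNorm HasMaj)
open Literature.MathematicalPhysics.QuantumFieldTheory.Balaban1983to89.B6UnitTorusCarrier (unitTorusGeo)
open Literature.MathematicalPhysics.QuantumFieldTheory.Balaban1983to89.B5SiteBridgeP12 (MP)
open Literature.MathematicalPhysics.QuantumFieldTheory.Balaban1983to89.B5SettingP12Real (latticeSettingP12R)
open Literature.MathematicalPhysics.QuantumFieldTheory.Balaban1983to89.T4EtaRateDefect (idef idef_comp idef_apply)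
open Literature.MathematicalPhysics.QuantumFieldTheory.Balaban1983to89.T4EtaRateCoeffDefect (pull pull_apply)
open Summit.QuantumFields.YangMills.BalabanUVNodes.N15.VectorPiece (blkFine kingPr kingPrV blkFine_comp_kingPrV)

variable {d : ℕ}

/-! ## §22 THE η-DEFECT OF A GENERAL IMAGES-DRESSED SANDWICH `χ_□ ∘ Sym ∘ X ∘ M_{χ_□}`, and ENTRY 2 `X = G∘∇*_ν` of the Neumann cubes -/

section Sandwich

variable {M : Fin (d + 1) → ℕ} [∀ μ, NeZero (M μ)] (L k r : ℕ) [NeZero L] (c : Tor M) (S : ℕ)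

/-- ★★★ **THE η-DEFECT OF AN IMAGES-DRESSED SANDWICH, EXACTLY**: for any torus operators `X`, `X′`,
`𝔇(χ′_□∘Sym′∘X′∘M_{χ′_□}, χ_□∘Sym∘X∘M_{χ_□}) = χ′_□∘Sym′∘𝔇(X′, X)∘M_{χ_□} + Σ_T M_{mask_T}∘P∘(χ_□∘R_T∘(D∘X∘M_{χ_□}))` (N-IIb's identity with `G` replaced by any `X`).
[cite: Balaban1985BackgroundPropagators, Thm 3.14 pp.426–427 (difference template); Balaban1984PropagatorsII, (2.37) p.229 (images)] -/
theorem idef_chiCube_symOp_sandwich (X' : (Tor (fine (L ^ r * L ^ k) M) × Fin (d + 1) → ℝ) →ₗ[ℝ] (Tor (fine (L ^ r * L ^ k) M) × Fin (d + 1) → ℝ))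
    (X : (Tor (fine (L ^ k) M) × Fin (d + 1) → ℝ) →ₗ[ℝ] (Tor (fine (L ^ k) M) × Fin (d + 1) → ℝ)) :
    idef (pull (kingPrV L k r M)) (pull (kingPrV L k r M))
        (mulOp (chiCube M (L ^ r * L ^ k) c S) ∘ₗ symOp M (L ^ r * L ^ k) c ∘ₗ X' ∘ₗ mulOp (chiCube M (L ^ r * L ^ k) c S))
        (mulOp (chiCube M (L ^ k) c S) ∘ₗ symOp M (L ^ k) c ∘ₗ X ∘ₗ mulOp (chiCube M (L ^ k) c S)) =
      mulOp (chiCube M (L ^ r * L ^ k) c S) ∘ₗ symOp M (L ^ r * L ^ k) c ∘ₗ idef (pull (kingPrV L k r M)) (pull (kingPrV L k r M)) X' X ∘ₗ mulOp (chiCube M (L ^ k) c S) +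
        ∑ T ∈ (Finset.univ : Finset (Fin (d + 1))).powerset,
          mulOp (faceMask M (L ^ r * L ^ k) (L ^ r) T) ∘ₗ pull (kingPrV L k r M) ∘ₗ
            (mulOp (chiCube M (L ^ k) c S) ∘ₗ reflSet M (L ^ k) c T ∘ₗ (ownDiff M (L ^ k) ∘ₗ X ∘ₗ mulOp (chiCube M (L ^ k) c S))) := by
  rw [idef_comp, idef_mulOp_chiCube, LinearMap.zero_comp, add_zero, idef_comp, idef_comp, idef_mulOp_chiCube, LinearMap.comp_zero, zero_add, idef_symOp_kingPrV,
    LinearMap.comp_add, fsum_comp, comp_fsum]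
  exact congrArg₂ (· + ·) rfl (Finset.sum_congr rfl fun T _ => faceTerm_eq L k r c S T _ _)

end Sandwich

section SandwichLetter

open Literature.MathematicalPhysics.QuantumFieldTheory.Balaban1983to89.B5CoverP12Lattice (Lθ Lθ_nonneg)

variable {L : ℕ} {M : Fin (d + 1) → ℕ} [∀ μ, NeZero (M μ)] {k n r : ℕ} [NeZero n] {c : Tor M} {S : ℕ}

omit [∀ μ, NeZero (M μ)] [NeZero n] in
/-- `s_D(μ, 1) = s_μ − 1`. [folklore] -/
theorem sD_one (μ : Fin (d + 1)) : sD M n μ 1 = sT M n μ - 1 := by rw [sD, one_smul]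

/-- ★ **THE OWN-DIRECTION DIFFERENCE FROM ONE-STEP LETTERS**: `ρ(s_μ − 1)∘X ≤ Ce^{−δd}` for every `μ` ⟹ `D∘X ≤ (d+1)·C·e^{−δd}` (the smallness is inside `C`, e.g. the Hölder step
`(1∕n)^α`). [cite: Balaban1984PropagatorsI, Prop. 1.2 (1.111) p.35 (Hölder letters, shape)] -/
theorem hasMaj_ownDiff_comp_of_steps {F₁ : Type} [AddCommGroup F₁] [Module ℝ F₁] {b₁ : BlockNorm (unitTorusGeo L k M) F₁} {X : F₁ →ₗ[ℝ] (Tor (fine n M) × Fin (d + 1) → ℝ)}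
    {C δ : ℝ} (hC : 0 ≤ C)
    (h : ∀ μ, HasMaj b₁ (BlockNorm.ofBlocks (unitTorusGeo L k M) (fun b : Tor (fine n M) × Fin (d + 1) => blockOf n M b.1)) (symbOp M n (sT M n μ - 1) ∘ₗ X)
      (fun y y' => C * Real.exp (-(δ * tdistT M y y')))) :
    HasMaj b₁ (BlockNorm.ofBlocks (unitTorusGeo L k M) (fun b : Tor (fine n M) × Fin (d + 1) => blockOf n M b.1)) (ownDiff M n ∘ₗ X)
      (fun y y' => (d + 1) * C * Real.exp (-(δ * tdistT M y y'))) := by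
  have hK0 : ∀ y y' : Tor M, 0 ≤ C * Real.exp (-(δ * tdistT M y y')) := fun y y' => mul_nonneg hC (Real.exp_nonneg _)
  have hterm : ∀ μ, HasMaj b₁ (BlockNorm.ofBlocks (unitTorusGeo L k M) (fun b : Tor (fine n M) × Fin (d + 1) => blockOf n M b.1))
      ((mulOp (fun b : Tor (fine n M) × Fin (d + 1) => if b.2 = μ then (1 : ℝ) else 0) ∘ₗ symbOp M n (sD M n μ 1)) ∘ₗ X)
      (fun y y' => C * Real.exp (-(δ * tdistT M y y'))) := by
    intro μ
    rw [LinearMap.comp_assoc, sD_one]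
    exact hasMaj_mulOp_comp_of_abs_le_one _ (fun b => by split_ifs <;> simp) hK0 (h μ)
  rw [ownDiff, fsum_comp]
  refine (hasMaj_finsum _ _ _ fun μ _ => hterm μ).mono fun y y' => le_of_eq ?_
  rw [Finset.sum_const, Finset.card_univ, Fintype.card_fin, nsmul_eq_mul]
  push_cast
  ring

variable [NeZero L]

/-- ★★★ **THE η-DEFECT OF AN IMAGES-DRESSED SANDWICH FROM TORUS LETTERS** (any torus `M_ν = 2S`, `n = L^k`, `n′ = L^r·n`, any pair `X′, X`): the torus defect `𝔇(X′, X) ≤ C₀e^{−δd}` and the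
one-step differences `ρ(s_μ − 1)∘X ≤ C₁e^{−δd}` give `𝔇(χ′Sym′X′χ′, χSymXχ) ≤ 1_□1_□·2^{d+1}e^{δ}(C₀ + (d+1)C₁)·e^{−δd}`.
[cite: Balaban1985BackgroundPropagators, Thm 3.14 pp.426–427, (3.42) p.397 (shape); Balaban1984PropagatorsII, (2.133)–(2.134) p.247 (shapes), (2.37) p.229] -/
theorem hasMaj_idef_chiCube_symOp_sandwich_of (hM : ∀ ν, M ν = 2 * S)
    {X' : (Tor (fine (L ^ r * L ^ k) M) × Fin (d + 1) → ℝ) →ₗ[ℝ] (Tor (fine (L ^ r * L ^ k) M) × Fin (d + 1) → ℝ)}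
    {X : (Tor (fine (L ^ k) M) × Fin (d + 1) → ℝ) →ₗ[ℝ] (Tor (fine (L ^ k) M) × Fin (d + 1) → ℝ)} {C₀ C₁ δ : ℝ} (hC₀ : 0 ≤ C₀) (hC₁ : 0 ≤ C₁) (hδ : 0 ≤ δ)
    (h0 : HasMaj (BlockNorm.ofBlocks (unitTorusGeo L k M) (fun b : Tor (fine (L ^ k) M) × Fin (d + 1) => blockOf (L ^ k) M b.1))
      (BlockNorm.ofBlocks (unitTorusGeo L k M) (fun b' : Tor (fine (L ^ r * L ^ k) M) × Fin (d + 1) => blockOf (L ^ r * L ^ k) M b'.1))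
      (idef (pull (kingPrV L k r M)) (pull (kingPrV L k r M)) X' X) (fun y y' => C₀ * Real.exp (-(δ * tdistT M y y'))))
    (h1 : ∀ μ, HasMaj (BlockNorm.ofBlocks (unitTorusGeo L k M) (fun b : Tor (fine (L ^ k) M) × Fin (d + 1) => blockOf (L ^ k) M b.1))
      (BlockNorm.ofBlocks (unitTorusGeo L k M) (fun b : Tor (fine (L ^ k) M) × Fin (d + 1) => blockOf (L ^ k) M b.1))
      (symbOp M (L ^ k) (sT M (L ^ k) μ - 1) ∘ₗ X) (fun y y' => C₁ * Real.exp (-(δ * tdistT M y y')))) :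
    HasMaj (BlockNorm.ofBlocks (unitTorusGeo L k M) (fun b : Tor (fine (L ^ k) M) × Fin (d + 1) => blockOf (L ^ k) M b.1))
      (BlockNorm.ofBlocks (unitTorusGeo L k M) (fun b' : Tor (fine (L ^ r * L ^ k) M) × Fin (d + 1) => blockOf (L ^ r * L ^ k) M b'.1))
      (idef (pull (kingPrV L k r M)) (pull (kingPrV L k r M))
        (mulOp (chiCube M (L ^ r * L ^ k) c S) ∘ₗ symOp M (L ^ r * L ^ k) c ∘ₗ X' ∘ₗ mulOp (chiCube M (L ^ r * L ^ k) c S))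
        (mulOp (chiCube M (L ^ k) c S) ∘ₗ symOp M (L ^ k) c ∘ₗ X ∘ₗ mulOp (chiCube M (L ^ k) c S)))
      (fun y y' => ind (cubeBlocks M c S : Set (Tor M)) y * ind (cubeBlocks M c S : Set (Tor M)) y' *
        (2 ^ (d + 1) * Real.exp δ * (C₀ + (d + 1) * C₁) * Real.exp (-(δ * tdistT M y y')))) := by
  rw [idef_chiCube_symOp_sandwich L k r c S X' X]
  have hT1 := hasMaj_chiCube_symOp_comp hC₀ hδ hM (hasMaj_comp_mulOp_chiCube (c := c) (S := S) (fun _ _ => mul_nonneg hC₀ (Real.exp_nonneg _)) h0)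
  have hD := hasMaj_ownDiff_comp_of_steps hC₁ h1
  have hC3 : (0 : ℝ) ≤ (d + 1) * C₁ := by positivity
  have hX : HasMaj (BlockNorm.ofBlocks (unitTorusGeo L k M) (fun b : Tor (fine (L ^ k) M) × Fin (d + 1) => blockOf (L ^ k) M b.1))
      (BlockNorm.ofBlocks (unitTorusGeo L k M) (fun b : Tor (fine (L ^ k) M) × Fin (d + 1) => blockOf (L ^ k) M b.1))
      (ownDiff M (L ^ k) ∘ₗ X ∘ₗ mulOp (chiCube M (L ^ k) c S))
      (fun y y' => ind (cubeBlocks M c S : Set (Tor M)) y' * ((d + 1) * C₁ * Real.exp (-(δ * tdistT M y y')))) :=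
    (hasMaj_comp_mulOp_chiCube (c := c) (S := S) (fun _ _ => mul_nonneg hC3 (Real.exp_nonneg _)) hD).congr fun μ => rfl
  have hsum := hasMaj_finsum (Finset.univ : Finset (Fin (d + 1))).powerset _ _ fun T _ => hasMaj_faceTerm (r := r) (c := c) hM hC3 hδ T hX
  refine (hT1.add hsum).mono fun y y' => le_of_eq ?_
  rw [Finset.sum_const, Finset.card_powerset, Finset.card_univ, Fintype.card_fin, nsmul_eq_mul]
  push_cast
  ring

/-- ★★★ **THE η-DEFECT LETTER OF ENTRY 2 OF THE NEUMANN CUBE PROPAGATORS AT `U ≡ 1`, HYPOTHESIS-FREE** on the torus family (coarse scales with `L^k ≥ 4`): with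
`F_□ = χ_□ ∘ Sym ∘ (G∘∇*_ν) ∘ M_{χ_□}` (N-IId's entry-2 operator) and its fine twin, `𝔇(F′_□, F_□) ≤ 1_□(y)1_□(y′)·m·(L^k)^{−1∕(8(d+1))}·e^{−δ|y−y′|_T}` — the torus pair's entry-2
defect (part `hasMaj_twoGridDefect_div`, rate `(L^k)^{−1∕(8(d+1))}`) dressed by the images, the faces by the Hölder one-step letter `hasMaj_divSteps_of_ineq` (`(1∕L^k)^{½} ≤
(L^k)^{−1∕(8(d+1))}`).  The cube input of dag-n15-c's `hDK` for the `G_□∘E` pieces. [cite: Balaban1985BackgroundPropagators, Thm 3.14 pp.426–427, (3.42) p.397 (shape); King1986,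
Prop. 3.9 (3.74) p.665 (A = 0 model); Balaban1984PropagatorsII, (2.133) p.247, (2.37) p.229] -/
theorem hasMaj_idef_chiCube_gDivAdj (hLodd : Odd L) (hL2 : 2 ≤ L) {a : ℝ} (ha : 0 < a) :
    ∃ δ m : ℝ, 0 < δ ∧ 0 < m ∧ ∀ (mT k r : ℕ) (hk : 1 ≤ k) (hn4 : 4 ≤ L ^ k) (hL : Odd L ∧ 1 < L) (c : Tor (MP (paramsOf d L mT k hL))) (ν : Fin (d + 1)),
      HasMaj (BlockNorm.ofBlocks (unitTorusGeo L k (MP (paramsOf d L mT k hL))) (blkFine L k (MP (paramsOf d L mT k hL))))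
        (BlockNorm.ofBlocks (unitTorusGeo L k (MP (paramsOf d L mT k hL)))
          (fun i : Tor (fine (L ^ r * L ^ k) (MP (paramsOf d L mT k hL))) × Fin (d + 1) => blockOf (L ^ r * L ^ k) (MP (paramsOf d L mT k hL)) i.1))
        (idef (pull (kingPrV L k r (MP (paramsOf d L mT k hL)))) (pull (kingPrV L k r (MP (paramsOf d L mT k hL))))
          (mulOp (chiCube (MP (paramsOf d L mT k hL)) (L ^ r * L ^ k) c (L ^ mT)) ∘ₗ symOp (MP (paramsOf d L mT k hL)) (L ^ r * L ^ k) c ∘ₗ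
            (gOp (MP (paramsOf d L mT k hL)) (L ^ r * L ^ k) a ∘ₗ
              symbOp (MP (paramsOf d L mT k hL)) (L ^ r * L ^ k)
                (((L ^ r * L ^ k : ℕ) : ℝ) • (sTinv (MP (paramsOf d L mT k hL)) (L ^ r * L ^ k) ν - 1))) ∘ₗ
            mulOp (chiCube (MP (paramsOf d L mT k hL)) (L ^ r * L ^ k) c (L ^ mT)))
          (mulOp (chiCube (MP (paramsOf d L mT k hL)) (L ^ k) c (L ^ mT)) ∘ₗ symOp (MP (paramsOf d L mT k hL)) (L ^ k) c ∘ₗ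
            (gOp (MP (paramsOf d L mT k hL)) (L ^ k) a ∘ₗ
              symbOp (MP (paramsOf d L mT k hL)) (L ^ k) (((L ^ k : ℕ) : ℝ) • (sTinv (MP (paramsOf d L mT k hL)) (L ^ k) ν - 1))) ∘ₗ
            mulOp (chiCube (MP (paramsOf d L mT k hL)) (L ^ k) c (L ^ mT))))
        (fun y y' => ind ((cubeBlocks (MP (paramsOf d L mT k hL)) c (L ^ mT) : Finset _) : Set _) y *
          ind ((cubeBlocks (MP (paramsOf d L mT k hL)) c (L ^ mT) : Finset _) : Set _) y' *
          (m * ((L ^ k : ℕ) : ℝ) ^ (-(1 / (8 * ((d : ℝ) + 1)))) * Real.exp (-(δ * tdistT (MP (paramsOf d L mT k hL)) y y')))) := by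
  have hL : Odd L ∧ 1 < L := ⟨hLodd, by omega⟩
  obtain ⟨δ₂, C₂, hδ₂, hC₂, H0⟩ := hasMaj_twoGridDefect_div (d := d) hLodd hL2 ha
  obtain ⟨δ₀, C, Cα, Cε, Cαε, hδ₀, hC, H3⟩ := ineq110_114_pair (d := d) hL ha
  have hLθ0 : 0 ≤ Lθ (d + 1) := Lθ_nonneg _
  obtain ⟨δ, hδdef⟩ : ∃ δ : ℝ, δ = min δ₂ δ₀ := ⟨_, rfl⟩
  have hδpos : 0 < δ := hδdef ▸ lt_min hδ₂ hδ₀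
  have hδ₂le : δ ≤ δ₂ := hδdef ▸ min_le_left _ _
  have hδ₀le : δ ≤ δ₀ := hδdef ▸ min_le_right _ _
  obtain ⟨CH, hCH⟩ : ∃ CH : ℝ, CH = |Cα (1 / 2)| * (Lθ (d + 1) + 1) * Real.exp δ₀ := ⟨_, rfl⟩
  have hCH0 : 0 ≤ CH := by rw [hCH]; positivity
  refine ⟨δ, 2 ^ (d + 1) * Real.exp δ * (C₂ + (d + 1) * CH), hδpos, by positivity, fun mT k r hk hn4 hL' c ν => ?_⟩
  have hM : ∀ μ, MP (paramsOf d L mT k hL') μ = 2 * L ^ mT := fun μ => rfl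
  have hM2 : ∀ μ, 2 ≤ MP (paramsOf d L mT k hL') μ := fun μ => by
    rw [hM μ]; exact Nat.le_mul_of_pos_right 2 (pow_pos (by omega) _)
  have hn1 : 1 ≤ L ^ k := Nat.one_le_pow _ _ (by omega)
  have hnr1 : (1 : ℝ) ≤ ((L ^ k : ℕ) : ℝ) := by exact_mod_cast hn1
  have hnr0 : (0 : ℝ) < ((L ^ k : ℕ) : ℝ) := by linarith
  have hρ0 : 0 ≤ ((L ^ k : ℕ) : ℝ) ^ (-(1 / (8 * ((d : ℝ) + 1)))) := Real.rpow_nonneg hnr0.le _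
  -- entry-2 torus defect at this index, decay weakened to `δ`
  have h0 := hasMaj_rate_mono (A := C₂ * ((L ^ k : ℕ) : ℝ) ^ (-(1 / (8 * ((d : ℝ) + 1))))) (mul_nonneg hC₂.le hρ0) hδ₂le (H0 mT k r hk hL' ν)
  -- one forward step of `G∇*_ν`: Hölder letter at `α = ½`, `j = 1`
  have hstep0 : 0 ≤ |Cα (1 / 2)| * (Lθ (d + 1) + 1) * Real.exp δ₀ * (((1 : ℕ) : ℝ) / ((L ^ k : ℕ) : ℝ)) ^ (1 / 2 : ℝ) :=
    mul_nonneg (by positivity) (Real.rpow_nonneg (by positivity) _)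
  have h1 : ∀ μ : Fin (d + 1), HasMaj (BlockNorm.ofBlocks (unitTorusGeo L k (MP (paramsOf d L mT k hL'))) (blkFine L k (MP (paramsOf d L mT k hL'))))
      (BlockNorm.ofBlocks (unitTorusGeo L k (MP (paramsOf d L mT k hL'))) (blkFine L k (MP (paramsOf d L mT k hL'))))
      (symbOp (MP (paramsOf d L mT k hL')) (L ^ k) (sT (MP (paramsOf d L mT k hL')) (L ^ k) μ - 1) ∘ₗ
        (gOp (MP (paramsOf d L mT k hL')) (L ^ k) a ∘ₗ
          symbOp (MP (paramsOf d L mT k hL')) (L ^ k) (((L ^ k : ℕ) : ℝ) • (sTinv (MP (paramsOf d L mT k hL')) (L ^ k) ν - 1))))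
      (fun y y' => |Cα (1 / 2)| * (Lθ (d + 1) + 1) * Real.exp δ₀ * (((1 : ℕ) : ℝ) / ((L ^ k : ℕ) : ℝ)) ^ (1 / 2 : ℝ) *
        Real.exp (-(δ * tdistT (MP (paramsOf d L mT k hL')) y y'))) := by
    intro μ
    have h := hasMaj_divSteps_of_ineq (L := L) (k := k) (MP (paramsOf d L mT k hL')) (L ^ k) a hM2 (j := 1) (by omega) (H3 mT k r hk).1 hδ₀.le
      (α := 1 / 2) (by norm_num) (by norm_num) μ ν
    rw [pow_one] at h
    exact hasMaj_rate_mono hstep0 hδ₀le h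
  have hmain := hasMaj_idef_chiCube_symOp_sandwich_of (r := r) (c := c) hM (mul_nonneg hC₂.le hρ0) hstep0 hδpos.le h0 h1
  refine hmain.mono fun y y' => ?_
  -- `(1∕L^k)^{½} ≤ (L^k)^{−1∕(8(d+1))}`
  have hd0 : (0 : ℝ) ≤ (d : ℝ) := Nat.cast_nonneg d
  have hexp : (((1 : ℕ) : ℝ) / ((L ^ k : ℕ) : ℝ)) ^ (1 / 2 : ℝ) ≤ ((L ^ k : ℕ) : ℝ) ^ (-(1 / (8 * ((d : ℝ) + 1)))) := by
    rw [Nat.cast_one, one_div, Real.inv_rpow hnr0.le, ← Real.rpow_neg hnr0.le]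
    refine Real.rpow_le_rpow_of_exponent_le hnr1 ?_
    rw [neg_le_neg_iff, one_div, one_div]
    exact inv_anti₀ (by norm_num) (by nlinarith)
  have hstep : |Cα (1 / 2)| * (Lθ (d + 1) + 1) * Real.exp δ₀ * (((1 : ℕ) : ℝ) / ((L ^ k : ℕ) : ℝ)) ^ (1 / 2 : ℝ) ≤ CH * ((L ^ k : ℕ) : ℝ) ^ (-(1 / (8 * ((d : ℝ) + 1)))) := by
    rw [hCH]; exact mul_le_mul_of_nonneg_left hexp (by positivity)
  have h2d : (0 : ℝ) ≤ 2 ^ (d + 1) * Real.exp δ := by positivity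
  have hd1 : (0 : ℝ) ≤ (d : ℝ) + 1 := by positivity
  have hcoef : 2 ^ (d + 1) * Real.exp δ * (C₂ * ((L ^ k : ℕ) : ℝ) ^ (-(1 / (8 * ((d : ℝ) + 1)))) +
        (d + 1) * (|Cα (1 / 2)| * (Lθ (d + 1) + 1) * Real.exp δ₀ * (((1 : ℕ) : ℝ) / ((L ^ k : ℕ) : ℝ)) ^ (1 / 2 : ℝ))) ≤
      2 ^ (d + 1) * Real.exp δ * (C₂ + (d + 1) * CH) * ((L ^ k : ℕ) : ℝ) ^ (-(1 / (8 * ((d : ℝ) + 1)))) :=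
    calc 2 ^ (d + 1) * Real.exp δ * (C₂ * ((L ^ k : ℕ) : ℝ) ^ (-(1 / (8 * ((d : ℝ) + 1)))) +
          (d + 1) * (|Cα (1 / 2)| * (Lθ (d + 1) + 1) * Real.exp δ₀ * (((1 : ℕ) : ℝ) / ((L ^ k : ℕ) : ℝ)) ^ (1 / 2 : ℝ)))
        ≤ 2 ^ (d + 1) * Real.exp δ * (C₂ * ((L ^ k : ℕ) : ℝ) ^ (-(1 / (8 * ((d : ℝ) + 1)))) + (d + 1) * (CH * ((L ^ k : ℕ) : ℝ) ^ (-(1 / (8 * ((d : ℝ) + 1)))))) :=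
          mul_le_mul_of_nonneg_left (add_le_add_right (mul_le_mul_of_nonneg_left hstep hd1) _) h2d
      _ = 2 ^ (d + 1) * Real.exp δ * (C₂ + (d + 1) * CH) * ((L ^ k : ℕ) : ℝ) ^ (-(1 / (8 * ((d : ℝ) + 1)))) := by ring
  exact mul_le_mul_of_nonneg_left (mul_le_mul_of_nonneg_right hcoef (Real.exp_nonneg _)) (mul_nonneg (ind_nonneg _ _) (ind_nonneg _ _))

end SandwichLetter

end Summit.QuantumFields.YangMills.BalabanUVNodes.N15.TwoGrid
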